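import Literature.Geometry.Kaehler.ChainRadialStokes
import Literature.Geometry.Kaehler.LelongTheorem
import Literature.Geometry.GeometricMeasureTheory.RadialDensityTauberian
import HarnessLib

/-!
# The Lelong number of an analytic set exists (as a finite limit), by Monge–Ampère and a Tauberian argument

Let `A ⊆ Ω` be an analytic subset of pure dimension `p = q + 1 ≥ 1` of an open subset `Ω` of a
finite-dimensional complex inner product space `V`, `a ∈ V` and `𝐁(a, ρ) ⊆ Ω`, `ρ > 0`. Then the
mass ratios converge:

`𝓗^{2p}(A ∩ B(a, r)) / r^{2p} → Λ` as `r → 0⁺`, for some finite `Λ`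
(`HolomorphicChain.exists_tendsto_measure_inter_ball_div_pow`),

i.e. the **Lelong number** `n(A, a) = Λ/c(p)` of [Chirka1989, §15.1 Prop. 1] **exists** (and is
finite) — here for every centre `a`, obtained WITHOUT the monotonicity of the mass ratio, from:

* the Monge–Ampère densities of the radial profile weights `w_h(z) = g(log ‖z - a‖)`, `g' = h`,
  along the `d`-closed chain `[A]` (`ChainRadialStokes.lean`:
  `(dd^c w_h)ᵖ(ξ_A) = p! 2ᵖ ‖z-a‖^{-2p}(h(log‖z-a‖)ᵖ(1-σ) + ½h^{p-1}h'(log‖z-a‖)σ)`, `σ` the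
  tangential fraction `tangentialFraction`, a measurable version of `τ_A(a,z)/‖z-a‖²`), whose
  integrals over `reg A ∩ B(a, ρ)` do not depend on the profile `h` located left of `log ρ - 1`
  (Stokes, `setIntegral_twoPow_ddcForm_radialWeight_eq`);
* the Tauberian theorem `tendsto_measure_div_pow_of_profile_invariance`
  (`RadialDensityTauberian.lean`) applied to `μ = 𝓗^{2p} ⌞ (reg A ∩ B(a, ρ))`, the radius
  `radA a = ‖· - a‖` (modified at the centre) and `σ`;
* Lelong's theorem (finiteness of `μ`, `Lelong1957_hausdorffMeasure_inter_lt_top_holds`) and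
  `𝓗^{2p}(A ∩ S) = 𝓗^{2p}(reg A ∩ S)`.

Moreover (`exists_lelong_data`) the Monge–Ampère masses of the profile weights on every smaller
ball are computed by `Λ`: for `0 < ρ' ≤ ρ` and every profile `h` located left of `log ρ' - 1`,
`(p! 2ᵖ)⁻¹ ∫_{reg A ∩ B(a,ρ')} (dd^c w_h)ᵖ(ξ_A) d𝓗 = W(ρ') + Λ` with the **defect**
`W(ρ') = ∫_{reg A ∩ B(a,ρ')} ‖z-a‖^{-2p}(1 - σ) d𝓗` (`lelongW`), finite and tending to `0` with `ρ'`
(`tendsto_lelongW_zero`) — Chirka's formula `vol A_r = n c(p) r^{2p} + r^{2p} ∫_{A_r} ω₀ᵖ/p!`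
[Chirka1989, §15.1 (∗)] in Monge–Ampère form, the input of the comparison argument for
`n(A, a) = μ_a(A)`. This is step (D1) of the Monge–Ampère proof of [Chirka1989, §15.1 Prop. 2]
after [Demailly, *Complex analytic and differential geometry*, Ch. III (5.5)–(5.6), Thm. 7.7].

## References

* E. M. Chirka, *Complex Analytic Sets*, Kluwer 1989, §15.1 Prop. 1–2 and formula (∗) [Chirka1989].
* J.-P. Demailly, *Complex analytic and differential geometry*, Ch. III §5, §7.
-/

noncomputable section

open scoped Manifold Topology ENNReal InnerProductSpace ContDiff
open Set Filter MeasureTheory Metric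

universe u

namespace Literature.Geometry.Kaehler

open Literature.Geometry.GeometricMeasureTheory TwoForm

variable {V : Type u} [NormedAddCommGroup V] [InnerProductSpace ℂ V]
  [FiniteDimensional ℂ V] [MeasurableSpace V] [BorelSpace V]
  {Ω : TopologicalSpace.Opens V} {q : ℕ}

namespace HolomorphicChain

/-! ### The modified radius -/

/-- The **modified radius** `rad_a(z) = ‖z - a‖ + 𝟙_{a}(z)`: `‖z - a‖` off `a` and `1` at `a`
(positive everywhere; the centre is `𝓗^{2p}`-null). [folklore] -/
def radA (a : V) : V → ℝ := fun z => ‖z - a‖ + ({a} : Set V).indicator (fun _ => (1 : ℝ)) z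

omit [InnerProductSpace ℂ V] [FiniteDimensional ℂ V] in
/-- `rad_a` is measurable. [folklore] -/
theorem measurable_radA (a : V) : Measurable (radA a) :=
  (continuous_id.sub continuous_const).norm.measurable.add
    (measurable_const.indicator (measurableSet_singleton a))

omit [InnerProductSpace ℂ V] [FiniteDimensional ℂ V] [MeasurableSpace V] [BorelSpace V] in
/-- `rad_a = ‖· - a‖` off the centre. [folklore] -/
theorem radA_of_ne (a : V) {z : V} (hz : z ≠ a) : radA a z = ‖z - a‖ := by
  rw [radA, indicator_of_notMem (by simpa using hz), add_zero]

omit [InnerProductSpace ℂ V] [FiniteDimensional ℂ V] [MeasurableSpace V] [BorelSpace V] in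
/-- `rad_a(a) = 1`. [folklore] -/
theorem radA_self (a : V) : radA a a = 1 := by simp [radA]

omit [InnerProductSpace ℂ V] [FiniteDimensional ℂ V] [MeasurableSpace V] [BorelSpace V] in
/-- `rad_a > 0`. [folklore] -/
theorem radA_pos (a z : V) : 0 < radA a z := by
  by_cases hz : z = a
  · subst hz; rw [radA_self]; exact one_pos
  · rw [radA_of_ne a hz]; exact norm_pos_iff.2 (sub_ne_zero.2 hz)

omit [InnerProductSpace ℂ V] [FiniteDimensional ℂ V] [MeasurableSpace V] [BorelSpace V] in
/-- `{rad_a < r} = B(a, r) \ {a}` for `r ≤ 1`. [folklore] -/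
theorem setOf_radA_lt_eq (a : V) {r : ℝ} (hr : r ≤ 1) : {z : V | radA a z < r} = ball a r \ {a} := by
  ext z
  by_cases hz : z = a
  · subst hz
    simp only [mem_setOf_eq, radA_self, Set.mem_sdiff, mem_singleton_iff, not_true_eq_false, and_false,
      iff_false, not_lt]
    exact hr
  · simp only [mem_setOf_eq, radA_of_ne a hz, Set.mem_sdiff, mem_ball, dist_eq_norm, mem_singleton_iff]
    exact ⟨fun h => ⟨h, hz⟩, fun h => h.1⟩

/-! ### The tangential fraction `σ` -/

/-- `τ_T(a, ·)/‖· - a‖²` is a.e. measurable along the carrier. [folklore] -/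
theorem aemeasurable_tangentialSq_div (T : HolomorphicChain 𝓘(ℂ, V) Ω (q + 1)) (a : V) :
    AEMeasurable (fun z => T.tangentialSq a z / ‖z - a‖ ^ 2)
      ((μHE[2 * (q + 1)] : Measure V).restrict T.carrier) :=
  (T.aemeasurable_tangentialSq (Nat.succ_pos q) a).div (Continuous.measurable (by fun_prop)).aemeasurable

/-- The **tangential fraction** `σ_T(a, z) ∈ [0, 1]`: a measurable function of `z` which
`𝓗^{2p} ⌞ reg|T|`-a.e. equals `τ_T(a, z)/‖z - a‖² = ‖pr_{T_z}(z - a)‖²/‖z - a‖²`. [cite: Chirka1989, §15.1] -/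
def tangentialFraction (T : HolomorphicChain 𝓘(ℂ, V) Ω (q + 1)) (a : V) : V → ℝ := fun z =>
  max 0 (min 1 ((T.aemeasurable_tangentialSq_div a).mk (fun z => T.tangentialSq a z / ‖z - a‖ ^ 2) z))

/-- `σ` is measurable. [folklore] -/
theorem measurable_tangentialFraction (T : HolomorphicChain 𝓘(ℂ, V) Ω (q + 1)) (a : V) :
    Measurable (T.tangentialFraction a) :=
  measurable_const.max (measurable_const.min (T.aemeasurable_tangentialSq_div a).measurable_mk)

/-- `σ ≥ 0`. [folklore] -/
theorem tangentialFraction_nonneg (T : HolomorphicChain 𝓘(ℂ, V) Ω (q + 1)) (a z : V) :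
    0 ≤ T.tangentialFraction a z := le_max_left _ _

/-- `σ ≤ 1`. [folklore] -/
theorem tangentialFraction_le_one (T : HolomorphicChain 𝓘(ℂ, V) Ω (q + 1)) (a z : V) :
    T.tangentialFraction a z ≤ 1 := max_le zero_le_one (min_le_left _ _)

/-- **`σ = τ/‖z - a‖²` almost everywhere along the carrier.** [folklore] -/
theorem ae_tangentialFraction_eq (T : HolomorphicChain 𝓘(ℂ, V) Ω (q + 1)) (a : V) :
    ∀ᵐ z ∂((μHE[2 * (q + 1)] : Measure V).restrict T.carrier),
      T.tangentialFraction a z = T.tangentialSq a z / ‖z - a‖ ^ 2 := by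
  filter_upwards [ae_restrict_mem T.measurableSet_carrier, (T.aemeasurable_tangentialSq_div a).ae_eq_mk]
    with z hz hzσ
  have hz0 : 0 ≤ T.tangentialSq a z / ‖z - a‖ ^ 2 := div_nonneg (T.tangentialSq_nonneg a z) (sq_nonneg _)
  have hz1 : T.tangentialSq a z / ‖z - a‖ ^ 2 ≤ 1 := div_le_one_of_le₀ (T.tangentialSq_le a hz) (sq_nonneg _)
  simp only [tangentialFraction]
  rw [← hzσ, min_eq_right hz1, max_eq_right hz0]

omit [FiniteDimensional ℂ V] in
/-- The centre is `𝓗^{2p} ⌞ reg|T|`-null: almost every point is off `a`. [folklore] -/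
theorem ae_ne_centre (T : HolomorphicChain 𝓘(ℂ, V) Ω (q + 1)) (a : V) :
    ∀ᵐ z ∂((μHE[2 * (q + 1)] : Measure V).restrict T.carrier), z ≠ a := by
  have hnull : ((μHE[2 * (q + 1)] : Measure V).restrict T.carrier) {a} = 0 :=
    le_antisymm ((Measure.restrict_apply_le _ _).trans
      (euclideanHausdorffMeasure_singleton (Nat.succ_pos q) a).le) zero_le
  rw [ae_iff]
  simp only [ne_eq, not_not, setOf_eq_eq_singleton]
  exact hnull

/-! ### The Monge–Ampère density of a profile weight is the profile integrand, a.e. -/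

/-- **Along the carrier, `(dd^c w_h)^{q+1}(ξ_T) = (q+1)! 2^{q+1} · I_h` a.e.**, where
`I_h(z) = rad^{-2(q+1)} (h(log rad)^{q+1} (1 - σ) + ½h^q h'(log rad) σ)` is the profile integrand of
`RadialDensityTauberian.lean` for `rad = radA a`, `σ = tangentialFraction`. [cite: Chirka1989, §15.1] -/
theorem ae_twoPow_ddcForm_radialWeight_eq (T : HolomorphicChain 𝓘(ℂ, V) Ω (q + 1))
    {h : ℝ → ℝ} {s ε : ℝ} (hh : IsProfileTransition h s ε) (a : V) :
    ∀ᵐ z ∂((μHE[2 * (q + 1)] : Measure V).restrict T.carrier),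
      (ddcForm (radialWeight h s ε a) z).twoPow (q + 1) (T.orientationFrame z) =
        ((q + 1).factorial : ℝ) * 2 ^ (q + 1) * ((radA a z ^ (2 * (q + 1)))⁻¹ *
          (h (Real.log (radA a z)) ^ (q + 1) * (1 - T.tangentialFraction a z) +
            profileKernel h (q + 1) (Real.log (radA a z)) * T.tangentialFraction a z)) := by
  filter_upwards [ae_restrict_mem T.measurableSet_carrier, T.ae_ne_centre a, T.ae_tangentialFraction_eq a]
    with z hz hza hσ
  rw [T.twoPow_ddcForm_radialWeight_orientationFrame hh a hz hza, radA_of_ne a hza, hσ]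
  ring

/-- The profile integrand along `T` is non-negative. [folklore] -/
theorem profileIntegrand_radA_nonneg (T : HolomorphicChain 𝓘(ℂ, V) Ω (q + 1))
    {h : ℝ → ℝ} {s ε : ℝ} (hh : IsProfileTransition h s ε) (a z : V) :
    0 ≤ (radA a z ^ (2 * (q + 1)))⁻¹ *
      (h (Real.log (radA a z)) ^ (q + 1) * (1 - T.tangentialFraction a z) +
        profileKernel h (q + 1) (Real.log (radA a z)) * T.tangentialFraction a z) :=
  profileIntegrand_nonneg (rad := radA a) (σ := T.tangentialFraction a) hh
    (T.tangentialFraction_nonneg a) (T.tangentialFraction_le_one a) (radA_pos a) z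

/-! ### The defect `W(ρ)` -/

/-- The **defect** `W_T(a, ρ) = ∫_{reg|T| ∩ B(a,ρ)} ‖z - a‖^{-2(q+1)} (1 - σ) d𝓗^{2(q+1)}` — the
Monge–Ampère mass of `log ‖z - a‖` itself (Chirka's `∫_{A_ρ} ω₀ᵖ`), in `ℝ≥0∞`.
[cite: Chirka1989, §15.1 formula (∗)] -/
def lelongW (T : HolomorphicChain 𝓘(ℂ, V) Ω (q + 1)) (a : V) (ρ : ℝ) : ℝ≥0∞ :=
  ∫⁻ z in T.carrier ∩ ball a ρ,
    ENNReal.ofReal ((radA a z ^ (2 * (q + 1)))⁻¹ * (1 - T.tangentialFraction a z)) ∂(μHE[2 * (q + 1)] : Measure V)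

/-- `W` is monotone in the radius. [folklore] -/
theorem lelongW_mono (T : HolomorphicChain 𝓘(ℂ, V) Ω (q + 1)) (a : V) {ρ ρ' : ℝ} (h : ρ' ≤ ρ) :
    T.lelongW a ρ' ≤ T.lelongW a ρ :=
  lintegral_mono_set (inter_subset_inter_right _ (ball_subset_ball h))

/-! ### The Tauberian data of `[A]` on a ball -/

section OfSet

variable {A : Set Ω} (hA : HasPureDim 𝓘(ℂ, V) A (q + 1))

/-- Lelong: `𝓗^{2(q+1)}(reg A ∩ 𝐁(a, ρ)) < ∞` when `𝐁(a, ρ) ⊆ Ω`. [cite: Chirka1989, §14.1 Thm.] -/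
theorem measure_carrier_ofSet_inter_closedBall_lt_top {a : V} {ρ : ℝ}
    (hΩ : closedBall a ρ ⊆ (Ω : Set V)) :
    (μHE[2 * (q + 1)] : Measure V) ((ofSet A hA).carrier ∩ closedBall a ρ) < ⊤ :=
  (ofSet A hA).measure_carrier_inter_lt_top_of_lelong Lelong1957_hausdorffMeasure_inter_lt_top_holds
    (isCompact_closedBall a ρ) hΩ

/-- **Integrability** of the Monge–Ampère densities of smooth weights on `reg A ∩ B(a, ρ)`. [folklore] -/
theorem integrableOn_twoPow_ddcForm_ofSet {u : V → ℝ} (hu : ContDiff ℝ ∞ u) {a : V} {ρ : ℝ}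
    (hΩ : closedBall a ρ ⊆ (Ω : Set V)) :
    IntegrableOn (fun z => (ddcForm u z).twoPow (q + 1) ((ofSet A hA).orientationFrame z))
      ((ofSet A hA).carrier ∩ ball a ρ) (μHE[2 * (q + 1)] : Measure V) :=
  (ofSet A hA).integrableOn_twoPow_ddcForm_orientationFrame hu a ρ
    (measure_carrier_ofSet_inter_closedBall_lt_top hA hΩ)

/-- **Stokes for `[A]` on balls**: for profiles located left of `log ρ - 1`, the Monge–Ampère
integrals over `reg A ∩ B(a, ρ)` agree (`θ_A = 1`). [cite: Chirka1989, §15.1] -/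
theorem setIntegral_twoPow_ddcForm_radialWeight_ofSet_eq {h₁ h₂ : ℝ → ℝ} {s₁ ε₁ s₂ ε₂ : ℝ}
    (hh₁ : IsProfileTransition h₁ s₁ ε₁) (hh₂ : IsProfileTransition h₂ s₂ ε₂) {a : V} {ρ : ℝ}
    (hρ : 0 < ρ) (hs₁ : s₁ + ε₁ ≤ Real.log ρ - 1) (hs₂ : s₂ + ε₂ ≤ Real.log ρ - 1)
    (hΩ : closedBall a ρ ⊆ (Ω : Set V)) :
    ∫ z in (ofSet A hA).carrier ∩ ball a ρ,
        (ddcForm (radialWeight h₁ s₁ ε₁ a) z).twoPow (q + 1) ((ofSet A hA).orientationFrame z)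
        ∂(μHE[2 * (q + 1)] : Measure V) =
      ∫ z in (ofSet A hA).carrier ∩ ball a ρ,
        (ddcForm (radialWeight h₂ s₂ ε₂ a) z).twoPow (q + 1) ((ofSet A hA).orientationFrame z)
        ∂(μHE[2 * (q + 1)] : Measure V) := by
  set T := ofSet A hA with hT
  have hSm : MeasurableSet (T.carrier ∩ ball a ρ) := T.measurableSet_carrier.inter measurableSet_ball
  have hexp : Real.exp (Real.log ρ - 1) < ρ := by
    rw [Real.exp_sub, Real.exp_log hρ]
    have : (1 : ℝ) < Real.exp 1 := by linarith [Real.add_one_lt_exp (one_ne_zero : (1 : ℝ) ≠ 0)]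
    rw [div_lt_iff₀ (Real.exp_pos 1)]
    nlinarith
  have hθ : ∀ (h : ℝ → ℝ) (s ε : ℝ), EqOn
      (fun z => (ddcForm (radialWeight h s ε a) z).twoPow (q + 1) (T.orientationFrame z))
      (fun z => (T.density z : ℝ) *
        (ddcForm (radialWeight h s ε a) z).twoPow (q + 1) (T.orientationFrame z))
      (T.carrier ∩ ball a ρ) := by
    intro h s ε z hz
    simp only [hT, density_ofSet_of_mem_carrier hA hz.1, Int.cast_one, one_mul]
  have h1 := IntegrableOn.congr_fun (integrableOn_twoPow_ddcForm_ofSet hA (hh₁.contDiff_radialWeight a) hΩ)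
    (hθ h₁ s₁ ε₁) hSm
  have h2 := IntegrableOn.congr_fun (integrableOn_twoPow_ddcForm_ofSet hA (hh₂.contDiff_radialWeight a) hΩ)
    (hθ h₂ s₂ ε₂) hSm
  have hst := T.setIntegral_twoPow_ddcForm_radialWeight_eq hh₁ hh₂ hs₁ hs₂ hexp
    (ball_subset_closedBall.trans hΩ) h1 h2
  rw [setIntegral_congr_fun hSm (hθ h₁ s₁ ε₁), setIntegral_congr_fun hSm (hθ h₂ s₂ ε₂)]
  exact hst

/-- **The profile functional of `[A]` on `B(a, ρ)` is `((q+1)! 2^{q+1})⁻¹` times the Monge–Ampère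
mass of `w_h`.** [cite: Chirka1989, §15.1] -/
theorem lintegral_profileIntegrand_ofSet_eq {h : ℝ → ℝ} {s ε : ℝ} (hh : IsProfileTransition h s ε)
    {a : V} {ρ : ℝ} (hΩ : closedBall a ρ ⊆ (Ω : Set V)) :
    ∫⁻ z in (ofSet A hA).carrier ∩ ball a ρ, ENNReal.ofReal ((radA a z ^ (2 * (q + 1)))⁻¹ *
        (h (Real.log (radA a z)) ^ (q + 1) * (1 - (ofSet A hA).tangentialFraction a z) +
          profileKernel h (q + 1) (Real.log (radA a z)) * (ofSet A hA).tangentialFraction a z))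
        ∂(μHE[2 * (q + 1)] : Measure V) =
      ENNReal.ofReal ((((q + 1).factorial : ℝ) * 2 ^ (q + 1))⁻¹ *
        ∫ z in (ofSet A hA).carrier ∩ ball a ρ,
          (ddcForm (radialWeight h s ε a) z).twoPow (q + 1) ((ofSet A hA).orientationFrame z)
          ∂(μHE[2 * (q + 1)] : Measure V)) := by
  set T := ofSet A hA with hT
  set μ : Measure V := (μHE[2 * (q + 1)] : Measure V).restrict (T.carrier ∩ ball a ρ) with hμ
  have hμle : μ ≤ (μHE[2 * (q + 1)] : Measure V).restrict T.carrier :=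
    Measure.restrict_mono inter_subset_left le_rfl
  have hc : (((q + 1).factorial : ℝ) * 2 ^ (q + 1)) ≠ 0 := by positivity
  have hint : Integrable (fun z => (ddcForm (radialWeight h s ε a) z).twoPow (q + 1)
      (T.orientationFrame z)) μ :=
    integrableOn_twoPow_ddcForm_ofSet hA (hh.contDiff_radialWeight a) hΩ
  have heq : (fun z => (radA a z ^ (2 * (q + 1)))⁻¹ *
      (h (Real.log (radA a z)) ^ (q + 1) * (1 - T.tangentialFraction a z) +
        profileKernel h (q + 1) (Real.log (radA a z)) * T.tangentialFraction a z)) =ᵐ[μ]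
      fun z => (((q + 1).factorial : ℝ) * 2 ^ (q + 1))⁻¹ *
        (ddcForm (radialWeight h s ε a) z).twoPow (q + 1) (T.orientationFrame z) := by
    filter_upwards [ae_mono hμle (T.ae_twoPow_ddcForm_radialWeight_eq hh a)] with z hz
    rw [hz, ← mul_assoc, inv_mul_cancel₀ hc, one_mul]
  have hIint : Integrable (fun z => (radA a z ^ (2 * (q + 1)))⁻¹ *
      (h (Real.log (radA a z)) ^ (q + 1) * (1 - T.tangentialFraction a z) +
        profileKernel h (q + 1) (Real.log (radA a z)) * T.tangentialFraction a z)) μ :=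
    ((hint.const_mul _).congr heq.symm)
  show ∫⁻ z, _ ∂μ = ENNReal.ofReal (_ * ∫ z, _ ∂μ)
  rw [← integral_const_mul, ← integral_congr_ae heq,
    ofReal_integral_eq_lintegral_ofReal hIint (ae_of_all _ fun z => T.profileIntegrand_radA_nonneg hh a z)]

/-- **The Tauberian theorem applied to `[A]` on `B(a, ρ)`**: the mass ratios of `A` at `a` tend to
`L(ρ) - W(ρ)`, where `L(ρ)` is the common value of the profile functionals on `B(a, ρ)` (any profile
located left of `log ρ - 1`). [cite: Chirka1989, §15.1 Prop. 1] -/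
theorem tendsto_measure_inter_ball_div_pow_sub {a : V} {ρ : ℝ} (hρ : 0 < ρ)
    (hΩ : closedBall a ρ ⊆ (Ω : Set V)) {h : ℝ → ℝ} {s ε : ℝ} (hh : IsProfileTransition h s ε)
    (hs : s + ε ≤ Real.log ρ - 1) :
    Tendsto (fun r : ℝ => (μHE[2 * (q + 1)] : Measure V) (((↑) : Ω → V) '' A ∩ ball a r) /
        ENNReal.ofReal (r ^ (2 * (q + 1)))) (𝓝[>] 0)
      (𝓝 (ENNReal.ofReal ((((q + 1).factorial : ℝ) * 2 ^ (q + 1))⁻¹ *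
          ∫ z in (ofSet A hA).carrier ∩ ball a ρ,
            (ddcForm (radialWeight h s ε a) z).twoPow (q + 1) ((ofSet A hA).orientationFrame z)
            ∂(μHE[2 * (q + 1)] : Measure V)) - (ofSet A hA).lelongW a ρ)) := by
  classical
  set T := ofSet A hA with hT
  set S := T.carrier ∩ ball a ρ with hS
  have hSm : MeasurableSet S := T.measurableSet_carrier.inter measurableSet_ball
  set μ : Measure V := (μHE[2 * (q + 1)] : Measure V).restrict S with hμ
  have hμS : (μHE[2 * (q + 1)] : Measure V) S < ⊤ :=
    (measure_mono (inter_subset_inter_right _ ball_subset_closedBall)).trans_lt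
      (measure_carrier_ofSet_inter_closedBall_lt_top hA hΩ)
  haveI : IsFiniteMeasure μ := ⟨by rw [hμ, Measure.restrict_apply_univ]; exact hμS⟩
  -- the profile-invariance hypothesis
  set x₀ := Real.log ρ - 1 with hx₀
  set L : ℝ≥0∞ := ENNReal.ofReal ((((q + 1).factorial : ℝ) * 2 ^ (q + 1))⁻¹ *
    ∫ z in S, (ddcForm (radialWeight h s ε a) z).twoPow (q + 1) (T.orientationFrame z)
      ∂(μHE[2 * (q + 1)] : Measure V)) with hL
  have H : ∀ (h' : ℝ → ℝ) (s' ε' : ℝ), 0 < ε' → s' + ε' ≤ x₀ → IsProfileTransition h' s' ε' →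
      ∫⁻ z, ENNReal.ofReal ((radA a z ^ (2 * (q + 1)))⁻¹ *
        (h' (Real.log (radA a z)) ^ (q + 1) * (1 - T.tangentialFraction a z) +
          profileKernel h' (q + 1) (Real.log (radA a z)) * T.tangentialFraction a z)) ∂μ = L := by
    intro h' s' ε' _ hs' hh'
    rw [hμ, lintegral_profileIntegrand_ofSet_eq hA hh' hΩ, hL,
      setIntegral_twoPow_ddcForm_radialWeight_ofSet_eq hA hh' hh hρ hs' hs hΩ]
  have hlim := tendsto_measure_div_pow_of_profile_invariance (μ := μ) (x₀ := x₀) (measurable_radA a)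
    (radA_pos a) (T.measurable_tangentialFraction a) (T.tangentialFraction_nonneg a)
    (T.tangentialFraction_le_one a) le_add_self ENNReal.ofReal_ne_top H
  refine hlim.congr' ?_
  -- `μ {rad < r} = 𝓗(A ∩ B(a, r))` for small `r`
  filter_upwards [Ioc_mem_nhdsGT (lt_min hρ one_pos)] with r hr
  have hrρ : r ≤ ρ := hr.2.trans (min_le_left _ _)
  congr 1
  rw [hμ, Measure.restrict_apply' hSm, setOf_radA_lt_eq a (hr.2.trans (min_le_right _ _)),
    measure_image_inter_eq_carrier_inter hA (ball a r), ← hT]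
  have hset : (ball a r \ {a}) ∩ S = (T.carrier ∩ ball a r) \ {a} := by
    ext z
    simp only [hS, mem_inter_iff, Set.mem_sdiff, mem_singleton_iff, mem_ball]
    constructor
    · rintro ⟨⟨h1, h2⟩, h3, _⟩; exact ⟨⟨h3, h1⟩, h2⟩
    · rintro ⟨⟨h1, h2⟩, h3⟩; exact ⟨⟨h2, h3⟩, h1, lt_of_lt_of_le h2 hrρ⟩
  rw [hset, measure_sdiff_null (euclideanHausdorffMeasure_singleton (Nat.succ_pos q) a)]

/-- The defect is at most the profile functional: `W(ρ) ≤ L(ρ)`. [folklore] -/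
theorem lelongW_le {a : V} {ρ : ℝ} (hρ : 0 < ρ) (hΩ : closedBall a ρ ⊆ (Ω : Set V))
    {h : ℝ → ℝ} {s ε : ℝ} (hh : IsProfileTransition h s ε) (hs : s + ε ≤ Real.log ρ - 1) :
    (ofSet A hA).lelongW a ρ ≤ ENNReal.ofReal ((((q + 1).factorial : ℝ) * 2 ^ (q + 1))⁻¹ *
      ∫ z in (ofSet A hA).carrier ∩ ball a ρ,
        (ddcForm (radialWeight h s ε a) z).twoPow (q + 1) ((ofSet A hA).orientationFrame z)
        ∂(μHE[2 * (q + 1)] : Measure V)) := by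
  set T := ofSet A hA with hT
  set μ : Measure V := (μHE[2 * (q + 1)] : Measure V).restrict (T.carrier ∩ ball a ρ) with hμ
  have H : ∀ (h' : ℝ → ℝ) (s' ε' : ℝ), 0 < ε' → s' + ε' ≤ Real.log ρ - 1 → IsProfileTransition h' s' ε' →
      ∫⁻ z, ENNReal.ofReal ((radA a z ^ (2 * (q + 1)))⁻¹ *
        (h' (Real.log (radA a z)) ^ (q + 1) * (1 - T.tangentialFraction a z) +
          profileKernel h' (q + 1) (Real.log (radA a z)) * T.tangentialFraction a z)) ∂μ =
        ENNReal.ofReal ((((q + 1).factorial : ℝ) * 2 ^ (q + 1))⁻¹ *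
          ∫ z in T.carrier ∩ ball a ρ, (ddcForm (radialWeight h s ε a) z).twoPow (q + 1)
            (T.orientationFrame z) ∂(μHE[2 * (q + 1)] : Measure V)) := by
    intro h' s' ε' _ hs' hh'
    rw [hμ, lintegral_profileIntegrand_ofSet_eq hA hh' hΩ,
      setIntegral_twoPow_ddcForm_radialWeight_ofSet_eq hA hh' hh hρ hs' hs hΩ]
  exact lintegral_inv_pow_mul_one_sub_le (μ := μ) (measurable_radA a) (radA_pos a)
    (T.measurable_tangentialFraction a) (T.tangentialFraction_nonneg a) (T.tangentialFraction_le_one a) H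

/-- **The Lelong number of an analytic set exists, as a finite limit of the mass ratios**, and it
computes the Monge–Ampère masses of the profile weights on every small ball up to the defect:
for `A ⊆ Ω` of pure dimension `q + 1`, `𝐁(a, ρ) ⊆ Ω` with `ρ > 0`, there is `Λ < ∞` with
`𝓗^{2(q+1)}(A ∩ B(a,r)) / r^{2(q+1)} → Λ` as `r → 0⁺`, and
`((q+1)! 2^{q+1})⁻¹ ∫_{reg A ∩ B(a,ρ')} (dd^c w_h)^{q+1}(ξ_A) d𝓗 = W(ρ') + Λ` for every `0 < ρ' ≤ ρ`
and every profile `h` located left of `log ρ' - 1`. [cite: Chirka1989, §15.1 Prop. 1 and formula (∗)] -/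
theorem exists_lelong_data {a : V} {ρ : ℝ} (hρ : 0 < ρ) (hΩ : closedBall a ρ ⊆ (Ω : Set V)) :
    ∃ Λ : ℝ≥0∞, Λ ≠ ⊤ ∧
      Tendsto (fun r : ℝ => (μHE[2 * (q + 1)] : Measure V) (((↑) : Ω → V) '' A ∩ ball a r) /
        ENNReal.ofReal (r ^ (2 * (q + 1)))) (𝓝[>] 0) (𝓝 Λ) ∧
      ∀ ρ' ∈ Ioc 0 ρ, ∀ (h : ℝ → ℝ) (s ε : ℝ), IsProfileTransition h s ε → s + ε ≤ Real.log ρ' - 1 →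
        ENNReal.ofReal ((((q + 1).factorial : ℝ) * 2 ^ (q + 1))⁻¹ *
          ∫ z in (ofSet A hA).carrier ∩ ball a ρ',
            (ddcForm (radialWeight h s ε a) z).twoPow (q + 1) ((ofSet A hA).orientationFrame z)
            ∂(μHE[2 * (q + 1)] : Measure V)) = (ofSet A hA).lelongW a ρ' + Λ := by
  obtain ⟨h₀, hh₀⟩ := exists_isProfileTransition (Real.log ρ - 2) one_pos
  have hlim₀ := tendsto_measure_inter_ball_div_pow_sub hA hρ hΩ hh₀ (by linarith)
  refine ⟨_, ENNReal.sub_ne_top ENNReal.ofReal_ne_top, hlim₀, fun ρ' hρ' h s ε hh hs => ?_⟩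
  have hΩ' : closedBall a ρ' ⊆ (Ω : Set V) := (closedBall_subset_closedBall hρ'.2).trans hΩ
  have hlim := tendsto_measure_inter_ball_div_pow_sub hA hρ'.1 hΩ' hh hs
  -- uniqueness of the limit, and `W(ρ') ≤ L(ρ')`
  rw [← tendsto_nhds_unique hlim hlim₀, add_tsub_cancel_of_le (lelongW_le hA hρ'.1 hΩ' hh hs)]

include hA in
/-- **Existence of the Lelong number** (the limit statement alone). [cite: Chirka1989, §15.1 Prop. 1] -/
theorem exists_tendsto_measure_inter_ball_div_pow {a : V} {ρ : ℝ} (hρ : 0 < ρ)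
    (hΩ : closedBall a ρ ⊆ (Ω : Set V)) :
    ∃ Λ : ℝ≥0∞, Λ ≠ ⊤ ∧
      Tendsto (fun r : ℝ => (μHE[2 * (q + 1)] : Measure V) (((↑) : Ω → V) '' A ∩ ball a r) /
        ENNReal.ofReal (r ^ (2 * (q + 1)))) (𝓝[>] 0) (𝓝 Λ) := by
  obtain ⟨Λ, hΛ, hlim, -⟩ := exists_lelong_data hA hρ hΩ
  exact ⟨Λ, hΛ, hlim⟩

/-- **The defect is finite** on balls inside `Ω`. [folklore] -/
theorem lelongW_lt_top {a : V} {ρ : ℝ} (hρ : 0 < ρ) (hΩ : closedBall a ρ ⊆ (Ω : Set V)) :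
    (ofSet A hA).lelongW a ρ < ⊤ := by
  obtain ⟨h₀, hh₀⟩ := exists_isProfileTransition (Real.log ρ - 2) one_pos
  exact (lelongW_le hA hρ hΩ hh₀ (by linarith)).trans_lt ENNReal.ofReal_lt_top

/-- **The defect tends to `0` with the radius**: `W(ρ') → 0` as `ρ' → 0⁺` (it is the integral of a
fixed `𝓗 ⌞ reg A`-integrable function over `B(a, ρ')`, and the centre is null). [cite: Chirka1989, §15.1] -/
theorem tendsto_lelongW_zero {a : V} {ρ : ℝ} (hρ : 0 < ρ) (hΩ : closedBall a ρ ⊆ (Ω : Set V)) :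
    Tendsto (fun ρ' => (ofSet A hA).lelongW a ρ') (𝓝[>] 0) (𝓝 0) := by
  set T := ofSet A hA with hT
  set g : V → ℝ≥0∞ := fun z =>
    ENNReal.ofReal ((radA a z ^ (2 * (q + 1)))⁻¹ * (1 - T.tangentialFraction a z)) with hg
  -- the finite measure `ν = g · 𝓗 ⌞ (reg A ∩ B(a, ρ))`
  set ν : Measure V := ((μHE[2 * (q + 1)] : Measure V).restrict (T.carrier ∩ ball a ρ)).withDensity g
    with hν
  have hνW : ∀ ρ' ∈ Ioc 0 ρ, T.lelongW a ρ' = ν (ball a ρ') := by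
    intro ρ' hρ'
    rw [hν, withDensity_apply _ measurableSet_ball, Measure.restrict_restrict measurableSet_ball,
      show ball a ρ' ∩ (T.carrier ∩ ball a ρ) = T.carrier ∩ ball a ρ' from by
        rw [inter_comm, inter_assoc, inter_eq_right.2 (ball_subset_ball hρ'.2)]]
    rfl
  have hνfin : ν (ball a ρ) ≠ ⊤ := by
    rw [← hνW ρ ⟨hρ, le_rfl⟩]; exact (lelongW_lt_top hA hρ hΩ).ne
  -- continuity from above along `ρ/(n+1)`: the balls shrink into `{a}`, which is `ν`-null
  have hanti : Antitone fun n : ℕ => ball a (ρ / (n + 1)) := fun n m hnm =>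
    ball_subset_ball (by gcongr)
  have hcont := tendsto_measure_iInter_atTop (μ := ν) (fun n => measurableSet_ball.nullMeasurableSet)
    hanti ⟨0, by simpa using hνfin⟩
  have hInter : (⋂ n : ℕ, ball a (ρ / (n + 1))) ⊆ {a} := by
    intro z hz
    rw [mem_iInter] at hz
    by_contra hza
    have hd : 0 < dist z a := dist_pos.2 hza
    obtain ⟨n, hn⟩ := exists_nat_gt (ρ / dist z a)
    have h1 := hz n
    rw [mem_ball] at h1
    have h2 : ρ / (n + 1) < dist z a := by
      rw [div_lt_iff₀ (by positivity)]
      rw [div_lt_iff₀ hd] at hn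
      nlinarith
    linarith
  have hνa : ν {a} = 0 := by
    rw [hν, withDensity_apply _ (measurableSet_singleton a)]
    have : ((μHE[2 * (q + 1)] : Measure V).restrict (T.carrier ∩ ball a ρ)).restrict {a} = 0 := by
      rw [Measure.restrict_eq_zero, Measure.restrict_apply (measurableSet_singleton a)]
      exact measure_mono_null inter_subset_left (euclideanHausdorffMeasure_singleton (Nat.succ_pos q) a)
    rw [this, lintegral_zero_measure]
  have h0 : ν (⋂ n : ℕ, ball a (ρ / (n + 1))) = 0 := measure_mono_null hInter hνa
  rw [h0] at hcont
  -- from the sequence to the filter `𝓝[>] 0`, by monotonicity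
  rw [ENNReal.tendsto_nhds_zero]
  intro δ hδ
  obtain ⟨n, hn⟩ := (ENNReal.tendsto_nhds_zero.1 hcont δ hδ).exists
  have hρn : 0 < ρ / (n + 1) := by positivity
  filter_upwards [Ioc_mem_nhdsGT hρn] with ρ' hρ'
  have hρ'ρ : ρ' ≤ ρ := hρ'.2.trans (div_le_self hρ.le (by linarith [n.cast_nonneg (α := ℝ)]))
  rw [hνW ρ' ⟨hρ'.1, hρ'ρ⟩]
  exact (measure_mono (ball_subset_ball hρ'.2)).trans hn

end OfSet

end HolomorphicChain

end Literature.Geometry.Kaehler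

end
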